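import Literature.NumberTheory.CubicFields.SingularZeroModP
import Mathlib.Data.Fintype.Prod
import Mathlib.Data.Fintype.Card
import Mathlib.LinearAlgebra.Matrix.NonsingularInverse
import Mathlib.Algebra.Field.ZMod
import HarnessLib

/-!
# Singular zeros of binary cubic forms: transport under `GL₂`, the normal form at `(1 : 0)`

Topic `Literature/NumberTheory/CubicFields`; continues `SingularZeroModP.lean` (a nonzero form over
`𝔽_p` with `p ∣ Disc` has a singular zero; a point `≢ 0` lifts to the first row of an `SL₂(ℤ)` matrix)
and `MemUCriterion.lean` (`f_u`, `f_v`, the first two coefficients of `f ∘ γ`).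

Bhargava–Shankar–Tsimerman 2013, proof of Lemmas 11–12 (the `p`-adic densities of the splitting
types `T_p(1²1)`, `T_p(1³)` and of `𝒰_p`, whence Lemma 13: `μ(𝒱_p) = (p² − 1)²/p⁴`): a form with a
multiple root modulo `p` "can clearly be brought into the form `a ≡ b ≡ 0 (mod p)`, namely, by
sending the unique multiple root of `f` in `ℙ¹_{𝔽_p}` to the point `(1,0)` via a transformation in
`GL₂(ℤ)`", after which the densities are read off coefficient by coefficient. This file provides that
transport in the tree's vocabulary (all statements PROVED, no named facts):
* `BinaryCubic.equivProd` (`V(R) ≃ R⁴`), the `Fintype`/`Finite`/`DecidableEq` instances and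
  `card_eq : #V(R) = #R⁴`;
* `rowMul v γ = (u, v)γ`, `derivU_subst`, `derivV_subst` (the chain rule for `f ∘ γ`);
* `singSet f` — the singular zeros `{(u, v) : f = f_u = f_v = 0}`; `one_zero_mem_singSet`
  (`(1, 0)` is singular iff `a = b = 0`), `mem_singSet_subst_iff` (`(u,v)` is singular for `f ∘ γ`
  iff `(u,v)γ` is singular for `f`, `γ` invertible), `singSet_eq_of_a_eq_zero` (over a domain, a
  nonzero form singular at `(1,0)` has singular set exactly the line `v = 0`);
* over `𝔽_p`: `exists_sl2z_row_eq` (every point `≢ 0` is the first row of an `SL₂(ℤ)` matrix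
  mod `p`), `exists_mem_singSet_ne_zero` (a nonzero form with `Disc = 0` has a singular zero `≠ 0`),
  **`singSet_eq_range_smul`** (the singular zeros of a nonzero form are exactly the multiples of any
  nonzero one — the "unique multiple root") and **`card_singSet_ne_zero`** (`p − 1` of them are `≠ 0`).

## References

* M. Bhargava, A. Shankar, J. Tsimerman, *On the Davenport–Heilbronn theorems and second order
  terms*, Invent. Math. 193 (2013) 439–499 = arXiv:1005.0672, Lemmas 11–13 [BhargavaShankarTsimerman2012].
* H. Davenport, H. Heilbronn, *On the density of discriminants of cubic fields. II*, Proc. Roy.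
  Soc. London A 322 (1971) 405–420, §§2–4 [DavenportHeilbronn1971].
-/

namespace Literature.NumberTheory.CubicFields

namespace BinaryCubic

/-! ### `V(R) ≃ R⁴`; finiteness -/

section Equiv

variable {R : Type*}

/-- The coefficient vector: `V(R) ≃ R × R × R × R`, `f ↦ (a, b, c, d)`. [folklore] -/
def equivProd : BinaryCubic R ≃ R × R × R × R where
  toFun f := (f.a, f.b, f.c, f.d)
  invFun v := ⟨v.1, v.2.1, v.2.2.1, v.2.2.2⟩
  left_inv := fun ⟨_, _, _, _⟩ => rfl
  right_inv := fun ⟨_, _, _, _⟩ => rfl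

/-- `equivProd` on a form (definitional). [folklore] -/
@[simp] theorem equivProd_apply (f : BinaryCubic R) : equivProd f = (f.a, f.b, f.c, f.d) := rfl

/-- `V(R)` is finite when `R` is (`V(ℤ/mℤ)`). [folklore] -/
instance instFintype [Fintype R] : Fintype (BinaryCubic R) := Fintype.ofEquiv _ equivProd.symm

/-- `V(R)` is finite when `R` is. [folklore] -/
instance instFinite [Finite R] : Finite (BinaryCubic R) := Finite.of_equiv _ equivProd.symm

/-- Equality of forms is decidable when equality in `R` is. [folklore] -/
instance instDecidableEq [DecidableEq R] : DecidableEq (BinaryCubic R) := equivProd.decidableEq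

/-- The zero form. [folklore] -/
instance instZero [Zero R] : Zero (BinaryCubic R) := ⟨⟨0, 0, 0, 0⟩⟩

/-- Coefficients of the zero form. [folklore] -/
@[simp] theorem zero_a [Zero R] : (0 : BinaryCubic R).a = 0 := rfl

/-- Coefficients of the zero form. [folklore] -/
@[simp] theorem zero_b [Zero R] : (0 : BinaryCubic R).b = 0 := rfl

/-- Coefficients of the zero form. [folklore] -/
@[simp] theorem zero_c [Zero R] : (0 : BinaryCubic R).c = 0 := rfl

/-- Coefficients of the zero form. [folklore] -/
@[simp] theorem zero_d [Zero R] : (0 : BinaryCubic R).d = 0 := rfl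

/-- `f = 0` iff all four coefficients vanish. [folklore] -/
theorem eq_zero_iff [Zero R] {f : BinaryCubic R} : f = 0 ↔ f.a = 0 ∧ f.b = 0 ∧ f.c = 0 ∧ f.d = 0 := by
  constructor
  · rintro rfl
    exact ⟨rfl, rfl, rfl, rfl⟩
  · rintro ⟨ha, hb, hc, hd⟩
    exact BinaryCubic.ext ha hb hc hd

/-- `#V(R) = #R⁴`. [folklore] -/
theorem card_eq [Fintype R] : Fintype.card (BinaryCubic R) = Fintype.card R ^ 4 := by
  rw [Fintype.card_congr equivProd, Fintype.card_prod, Fintype.card_prod, Fintype.card_prod]; ring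

/-- `#V(R) = #R⁴` (`Nat.card`). [folklore] -/
theorem natCard_eq [Finite R] : Nat.card (BinaryCubic R) = Nat.card R ^ 4 := by
  have := Fintype.ofFinite R
  rw [Nat.card_eq_fintype_card, Nat.card_eq_fintype_card, card_eq]

end Equiv

/-! ### The chain rule for `f ∘ γ` and singular zeros -/

section CommRing

variable {R : Type*} [CommRing R] (f : BinaryCubic R)

/-- Change of ring of the zero form. [folklore] -/
@[simp] theorem map_zero_form {S : Type*} [CommRing S] (φ : R →+* S) : (0 : BinaryCubic R).map φ = 0 := by
  ext <;> simp [map]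

/-- `f.map φ = 0` iff every coefficient is killed by `φ`. [folklore] -/
theorem map_eq_zero_iff {S : Type*} [CommRing S] (φ : R →+* S) (g : BinaryCubic R) :
    g.map φ = 0 ↔ φ g.a = 0 ∧ φ g.b = 0 ∧ φ g.c = 0 ∧ φ g.d = 0 := by
  rw [eq_zero_iff]; rfl

/-- Substitution into the zero form. [folklore] -/
@[simp] theorem zero_subst (γ : Matrix (Fin 2) (Fin 2) R) : (0 : BinaryCubic R).subst γ = 0 := by
  ext <;> simp [subst]

/-- `Disc 0 = 0`. [folklore] -/
@[simp] theorem disc_zero : (0 : BinaryCubic R).disc = 0 := by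
  simp [disc_eq]

/-- Row vector times matrix: `(u, v)γ = (uγ₀₀ + vγ₁₀, uγ₀₁ + vγ₁₁)` (the substitution behind
`f.subst γ`, `eval_subst`). [folklore] -/
def rowMul (v : R × R) (γ : Matrix (Fin 2) (Fin 2) R) : R × R :=
  (v.1 * γ 0 0 + v.2 * γ 1 0, v.1 * γ 0 1 + v.2 * γ 1 1)

/-- `(u,v)(γδ) = ((u,v)γ)δ`. [folklore] -/
theorem rowMul_mul (v : R × R) (γ δ : Matrix (Fin 2) (Fin 2) R) : rowMul v (γ * δ) = rowMul (rowMul v γ) δ := by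
  simp only [rowMul, Matrix.mul_apply, Fin.sum_univ_two, Prod.mk.injEq]
  constructor <;> ring

/-- `(u,v)·1 = (u,v)`. [folklore] -/
@[simp] theorem rowMul_one (v : R × R) : rowMul v 1 = v := by
  simp [rowMul]

/-- `(1,0)γ` is the first row of `γ`. [folklore] -/
@[simp] theorem one_zero_rowMul (γ : Matrix (Fin 2) (Fin 2) R) : rowMul (1, 0) γ = (γ 0 0, γ 0 1) := by
  simp [rowMul]

/-- `rowMul` commutes with change of ring. [folklore] -/
theorem rowMul_map {S : Type*} [CommRing S] (φ : R →+* S) (v : R × R) (γ : Matrix (Fin 2) (Fin 2) R) :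
    rowMul (φ v.1, φ v.2) (γ.map φ) = (φ (rowMul v γ).1, φ (rowMul v γ).2) := by
  simp [rowMul]

/-- `(f ∘ γ)(u,v) = f((u,v)γ)` in `rowMul` form. [folklore] -/
theorem eval_subst_rowMul (γ : Matrix (Fin 2) (Fin 2) R) (v : R × R) :
    (f.subst γ).eval v.1 v.2 = f.eval (rowMul v γ).1 (rowMul v γ).2 :=
  eval_subst f γ v.1 v.2

/-- **Chain rule, `u`-derivative**: `(f ∘ γ)_u(u,v) = γ₀₀ f_u((u,v)γ) + γ₀₁ f_v((u,v)γ)`. [folklore] -/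
theorem derivU_subst (γ : Matrix (Fin 2) (Fin 2) R) (v : R × R) :
    (f.subst γ).derivU v.1 v.2 =
      γ 0 0 * f.derivU (rowMul v γ).1 (rowMul v γ).2 + γ 0 1 * f.derivV (rowMul v γ).1 (rowMul v γ).2 := by
  simp only [subst, derivU, derivV, rowMul]; ring

/-- **Chain rule, `v`-derivative**: `(f ∘ γ)_v(u,v) = γ₁₀ f_u((u,v)γ) + γ₁₁ f_v((u,v)γ)`. [folklore] -/
theorem derivV_subst (γ : Matrix (Fin 2) (Fin 2) R) (v : R × R) :
    (f.subst γ).derivV v.1 v.2 =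
      γ 1 0 * f.derivU (rowMul v γ).1 (rowMul v γ).2 + γ 1 1 * f.derivV (rowMul v γ).1 (rowMul v γ).2 := by
  simp only [subst, derivU, derivV, rowMul]; ring

/-- `(μ f)_u = μ f_u`. [folklore] -/
theorem derivU_smul (μ : R) (u v : R) : (μ • f).derivU u v = μ * f.derivU u v := by
  simp only [derivU, smul_a, smul_b, smul_c]; ring

/-- `(μ f)_v = μ f_v`. [folklore] -/
theorem derivV_smul (μ : R) (u v : R) : (μ • f).derivV u v = μ * f.derivV u v := by
  simp only [derivV, smul_b, smul_c, smul_d]; ring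

/-- **The singular zeros of `f`**: the points `(u, v)` with `f(u,v) = f_u(u,v) = f_v(u,v) = 0` (over
`𝔽_p`: the multiple roots of `f (mod p)`, Davenport–Heilbronn 1971 §2; BST 2013, proof of Lemma 12).
[cite: BhargavaShankarTsimerman2012, proof of Lemma 12 (the unique multiple root of f in ℙ¹(𝔽_p))] -/
def singSet : Set (R × R) :=
  {v | f.eval v.1 v.2 = 0 ∧ f.derivU v.1 v.2 = 0 ∧ f.derivV v.1 v.2 = 0}

/-- Membership in `singSet` (definitional). [folklore] -/
theorem mem_singSet {v : R × R} :
    v ∈ f.singSet ↔ f.eval v.1 v.2 = 0 ∧ f.derivU v.1 v.2 = 0 ∧ f.derivV v.1 v.2 = 0 :=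
  Iff.rfl

/-- **`(1, 0)` is a singular zero iff `a = b = 0`** (`f(1,0) = a`, `f_u(1,0) = 3a`, `f_v(1,0) = b`). [folklore] -/
theorem one_zero_mem_singSet : ((1 : R), (0 : R)) ∈ f.singSet ↔ f.a = 0 ∧ f.b = 0 := by
  simp only [mem_singSet, eval, derivU, derivV]
  constructor
  · rintro ⟨h1, -, h3⟩
    exact ⟨by simpa using h1, by simpa using h3⟩
  · rintro ⟨ha, hb⟩
    simp [ha, hb]

/-- `(0, 0)` is always a singular zero. [folklore] -/
theorem zero_mem_singSet : ((0 : R), (0 : R)) ∈ f.singSet := by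
  simp [mem_singSet, eval, derivU, derivV]

/-- Scaling the form does not lose singular zeros. [folklore] -/
theorem singSet_subset_singSet_smul (μ : R) : f.singSet ⊆ (μ • f).singSet := by
  rintro v ⟨h1, h2, h3⟩
  refine ⟨?_, ?_, ?_⟩
  · rw [eval_smul, h1, mul_zero]
  · rw [derivU_smul, h2, mul_zero]
  · rw [derivV_smul, h3, mul_zero]

/-- **Transport of singular zeros, easy direction**: if `(u,v)γ` is singular for `f` then `(u,v)` is
singular for `f ∘ γ` (chain rule). [folklore] -/
theorem mem_singSet_subst {γ : Matrix (Fin 2) (Fin 2) R} {v : R × R} (h : rowMul v γ ∈ f.singSet) :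
    v ∈ (f.subst γ).singSet := by
  obtain ⟨h1, h2, h3⟩ := h
  refine ⟨?_, ?_, ?_⟩
  · rw [eval_subst_rowMul, h1]
  · rw [derivU_subst, h2, h3, mul_zero, mul_zero, add_zero]
  · rw [derivV_subst, h2, h3, mul_zero, mul_zero, add_zero]

/-- `(f ∘ γ) ∘ γ⁻¹ = f` for invertible `γ`. [folklore] -/
theorem subst_subst_inv {γ : Matrix (Fin 2) (Fin 2) R} (hγ : IsUnit γ.det) : (f.subst γ).subst γ⁻¹ = f := by
  rw [← subst_mul, Matrix.nonsing_inv_mul γ hγ, subst_one]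

/-- `(f ∘ γ⁻¹) ∘ γ = f` for invertible `γ`. [folklore] -/
theorem subst_inv_subst {γ : Matrix (Fin 2) (Fin 2) R} (hγ : IsUnit γ.det) : (f.subst γ⁻¹).subst γ = f := by
  rw [← subst_mul, Matrix.mul_nonsing_inv γ hγ, subst_one]

/-- **Transport of singular zeros** under an invertible substitution: `(u,v)` is singular for `f ∘ γ`
iff `(u,v)γ` is singular for `f`. [folklore] -/
theorem mem_singSet_subst_iff {γ : Matrix (Fin 2) (Fin 2) R} (hγ : IsUnit γ.det) (v : R × R) :
    v ∈ (f.subst γ).singSet ↔ rowMul v γ ∈ f.singSet := by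
  refine ⟨fun h => ?_, mem_singSet_subst f⟩
  have key : rowMul v γ ∈ ((f.subst γ).subst γ⁻¹).singSet := by
    refine mem_singSet_subst (f.subst γ) ?_
    rwa [← rowMul_mul, Matrix.mul_nonsing_inv γ hγ, rowMul_one]
  rwa [subst_subst_inv f hγ] at key

/-- `subst` by an invertible matrix is a bijection of `V(R)`. [folklore] -/
noncomputable def substEquiv (γ : Matrix (Fin 2) (Fin 2) R) (hγ : IsUnit γ.det) : BinaryCubic R ≃ BinaryCubic R where
  toFun f := f.subst γ
  invFun f := f.subst γ⁻¹
  left_inv f := subst_subst_inv f hγ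
  right_inv f := subst_inv_subst f hγ

/-- `substEquiv γ hγ f = f.subst γ` (definitional). [folklore] -/
@[simp] theorem substEquiv_apply (γ : Matrix (Fin 2) (Fin 2) R) (hγ : IsUnit γ.det) (g : BinaryCubic R) :
    substEquiv γ hγ g = g.subst γ := rfl

/-- The zero form stays zero under substitution, and conversely for invertible `γ`. [folklore] -/
theorem subst_eq_zero_iff {γ : Matrix (Fin 2) (Fin 2) R} (hγ : IsUnit γ.det) : f.subst γ = 0 ↔ f = 0 := by
  refine ⟨fun h => ?_, fun h => by rw [h, zero_subst]⟩
  rw [← subst_subst_inv f hγ, h, zero_subst]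

/-- In coefficient form: a form with a nonzero coefficient keeps one under an invertible
substitution. [folklore] -/
theorem subst_ne_zero_iff {γ : Matrix (Fin 2) (Fin 2) R} (hγ : IsUnit γ.det) :
    ¬ ((f.subst γ).a = 0 ∧ (f.subst γ).b = 0 ∧ (f.subst γ).c = 0 ∧ (f.subst γ).d = 0) ↔
      ¬ (f.a = 0 ∧ f.b = 0 ∧ f.c = 0 ∧ f.d = 0) := by
  rw [← eq_zero_iff, ← eq_zero_iff, subst_eq_zero_iff f hγ]

/-- If `(1, 0)` is a singular zero then `Disc f = 0` (every monomial of `Disc` contains `a` or `b`). [folklore] -/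
theorem disc_eq_zero_of_one_zero_mem_singSet (h : ((1 : R), (0 : R)) ∈ f.singSet) : f.disc = 0 := by
  obtain ⟨ha, hb⟩ := (one_zero_mem_singSet f).mp h
  simp [disc_eq, ha, hb]

/-- If `f` has a singular zero that is the first row of an invertible matrix then `Disc f = 0`. [folklore] -/
theorem disc_eq_zero_of_row_mem_singSet {γ : Matrix (Fin 2) (Fin 2) R} (hγ : IsUnit γ.det)
    (h : (γ 0 0, γ 0 1) ∈ f.singSet) : f.disc = 0 := by
  have h1 : ((1 : R), (0 : R)) ∈ (f.subst γ).singSet := mem_singSet_subst f (by simpa using h)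
  have h2 := disc_eq_zero_of_one_zero_mem_singSet _ h1
  rw [disc_subst] at h2
  exact (hγ.pow 6).mul_right_eq_zero.mp h2

end CommRing

/-! ### The normal form at `(1 : 0)` over a domain -/

section Domain

variable {R : Type*} [CommRing R] [NoZeroDivisors R] (f : BinaryCubic R)

/-- **Normal form.** Over a domain, a nonzero form with `a = b = 0`, i.e. `f = v²(cu + dv)` with
`(c, d) ≠ (0, 0)`, has singular zeros exactly the points of the line `v = 0`. [folklore] -/
theorem singSet_eq_of_a_eq_zero (ha : f.a = 0) (hb : f.b = 0) (hcd : ¬ (f.c = 0 ∧ f.d = 0)) :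
    f.singSet = {v | v.2 = 0} := by
  ext ⟨r, s⟩
  simp only [mem_singSet, eval, derivU, derivV, ha, hb, Set.mem_setOf_eq, zero_mul, mul_zero, zero_add]
  constructor
  · rintro ⟨h1, h2, -⟩
    by_contra hs
    have hc : f.c = 0 := (mul_eq_zero.mp h2).resolve_right (pow_ne_zero 2 hs)
    have hd : f.d = 0 := by
      rw [hc, zero_mul, zero_mul, zero_add] at h1
      exact (mul_eq_zero.mp h1).resolve_right (pow_ne_zero 3 hs)
    exact hcd ⟨hc, hd⟩
  · rintro rfl
    simp

/-- Hence, for such a form, the singular zeros `≠ (0,0)` are the `(r, 0)` with `r ≠ 0`. [folklore] -/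
theorem mem_singSet_ne_zero_iff_of_a_eq_zero (ha : f.a = 0) (hb : f.b = 0) (hcd : ¬ (f.c = 0 ∧ f.d = 0))
    (v : R × R) : (v ∈ f.singSet ∧ v ≠ 0) ↔ (v.2 = 0 ∧ v.1 ≠ 0) := by
  rw [singSet_eq_of_a_eq_zero f ha hb hcd, Set.mem_setOf_eq]
  obtain ⟨r, s⟩ := v
  simp only [ne_eq, Prod.mk_eq_zero, not_and]
  constructor
  · rintro ⟨rfl, h⟩
    exact ⟨rfl, fun hr => h hr rfl⟩
  · rintro ⟨rfl, h⟩
    exact ⟨rfl, fun hr _ => h hr⟩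

end Domain

/-! ### Over `𝔽_p`: moving a point to `(1 : 0)`, the unique multiple root -/

section ZModP

variable {p : ℕ}

/-- **Transitivity on points mod `p`.** Every `(r₀, s₀) ≢ (0, 0)` in `𝔽_p²` is, modulo `p`, the first
row of an integral matrix of determinant `1` (lift to a primitive vector, `exists_isCoprime_congr`,
and complete it). [folklore] -/
theorem exists_sl2z_row_eq (hp : p.Prime) {r₀ s₀ : ZMod p} (h : ¬ (r₀ = 0 ∧ s₀ = 0)) :
    ∃ γ : Matrix (Fin 2) (Fin 2) ℤ, γ.det = 1 ∧ ((γ 0 0 : ℤ) : ZMod p) = r₀ ∧ ((γ 0 1 : ℤ) : ZMod p) = s₀ := by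
  haveI : NeZero p := ⟨hp.ne_zero⟩
  have h' : ¬ ((p : ℤ) ∣ (r₀.val : ℤ) ∧ (p : ℤ) ∣ (s₀.val : ℤ)) := by
    rintro ⟨hr, hs⟩
    rw [← ZMod.intCast_zmod_eq_zero_iff_dvd] at hr hs
    push_cast [ZMod.natCast_val, ZMod.cast_id] at hr hs
    exact h ⟨hr, hs⟩
  obtain ⟨r, s, hcop, hr, hs⟩ := exists_isCoprime_congr hp h'
  obtain ⟨u, v, huv⟩ := hcop
  refine ⟨!![r, s; -v, u], ?_, ?_, ?_⟩
  · rw [Matrix.det_fin_two_of]; linear_combination huv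
  · have := (ZMod.intCast_eq_intCast_iff_dvd_sub (r₀.val : ℤ) r p).mpr hr
    simpa [ZMod.natCast_val, ZMod.cast_id] using this.symm
  · have := (ZMod.intCast_eq_intCast_iff_dvd_sub (s₀.val : ℤ) s p).mpr hs
    simpa [ZMod.natCast_val, ZMod.cast_id] using this.symm

/-- **Existence of a singular zero** (from `exists_singular_zero_mod`): over `𝔽_p`, a nonzero form with
`Disc = 0` has a singular zero `≠ (0, 0)` — its multiple root. [folklore] -/
theorem exists_mem_singSet_ne_zero (hp : p.Prime) {f : BinaryCubic (ZMod p)}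
    (hf : ¬ (f.a = 0 ∧ f.b = 0 ∧ f.c = 0 ∧ f.d = 0)) (hD : f.disc = 0) : ∃ v ∈ f.singSet, v ≠ 0 := by
  haveI : NeZero p := ⟨hp.ne_zero⟩
  set F : BinaryCubic ℤ := ⟨(f.a.val : ℤ), (f.b.val : ℤ), (f.c.val : ℤ), (f.d.val : ℤ)⟩ with hFdef
  have hF : F.map (Int.castRingHom (ZMod p)) = f := by
    ext <;> simp [F, map, ZMod.natCast_val, ZMod.cast_id]
  have hmult : ¬ F.IsMultiple p := by
    rintro ⟨ha, hb, hc, hd⟩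
    simp only [hFdef] at ha hb hc hd
    rw [← ZMod.intCast_zmod_eq_zero_iff_dvd] at ha hb hc hd
    push_cast [ZMod.natCast_val, ZMod.cast_id] at ha hb hc hd
    exact hf ⟨ha, hb, hc, hd⟩
  have hdisc : (p : ℤ) ∣ F.disc := by
    rw [← ZMod.intCast_zmod_eq_zero_iff_dvd, ← eq_intCast (Int.castRingHom (ZMod p)), ← disc_map, hF, hD]
  obtain ⟨r, s, hrs, h1, h2, h3⟩ := exists_singular_zero_mod hp hmult hdisc
  refine ⟨((r : ZMod p), (s : ZMod p)), ⟨?_, ?_, ?_⟩, ?_⟩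
  · have := eval_map (Int.castRingHom (ZMod p)) F r s
    rw [hF, eq_intCast, eq_intCast, eq_intCast, (ZMod.intCast_zmod_eq_zero_iff_dvd _ _).mpr h1] at this
    exact this
  · have := derivU_map (f := F) (Int.castRingHom (ZMod p)) r s
    rw [hF, eq_intCast, eq_intCast, eq_intCast, (ZMod.intCast_zmod_eq_zero_iff_dvd _ _).mpr h2] at this
    exact this
  · have := derivV_map (f := F) (Int.castRingHom (ZMod p)) r s
    rw [hF, eq_intCast, eq_intCast, eq_intCast, (ZMod.intCast_zmod_eq_zero_iff_dvd _ _).mpr h3] at this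
    exact this
  · simp only [ne_eq, Prod.mk_eq_zero, ZMod.intCast_zmod_eq_zero_iff_dvd, not_and]
    exact fun hr hs => hrs ⟨hr, hs⟩

/-- **The unique multiple root.** Over `𝔽_p`, if a nonzero form `f` has a singular zero `v₀ ≠ (0,0)`,
then its singular zeros are exactly the multiples `t • v₀`, `t ∈ 𝔽_p` (move `v₀` to `(1,0)` by
`SL₂(ℤ)`; there `f = v²(cu + dv)` has singular set the line `v = 0`). [cite: BhargavaShankarTsimerman2012, proof of Lemma 12 (the unique multiple root of f in ℙ¹(𝔽_p), sent to (1,0) via GL₂(ℤ))] -/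
theorem singSet_eq_range_smul (hp : p.Prime) {f : BinaryCubic (ZMod p)}
    (hf : ¬ (f.a = 0 ∧ f.b = 0 ∧ f.c = 0 ∧ f.d = 0)) {v₀ : ZMod p × ZMod p} (hv₀ : v₀ ∈ f.singSet) (h0 : v₀ ≠ 0) :
    f.singSet = Set.range fun t : ZMod p => t • v₀ := by
  haveI : Fact p.Prime := ⟨hp⟩
  obtain ⟨γ, hdet, hr, hs⟩ := exists_sl2z_row_eq hp (r₀ := v₀.1) (s₀ := v₀.2)
    (by simpa [Prod.ext_iff] using h0)
  set δ : Matrix (Fin 2) (Fin 2) (ZMod p) := γ.map (Int.castRingHom (ZMod p)) with hδ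
  have hδdet : IsUnit δ.det := by
    rw [hδ, ← RingHom.mapMatrix_apply, ← RingHom.map_det, hdet, map_one]; exact isUnit_one
  have hrow : rowMul (1, 0) δ = v₀ := by
    rw [one_zero_rowMul]; ext <;> simp [δ, hr, hs]
  -- the translate `g = f ∘ δ` is singular at `(1, 0)` and nonzero
  have hg1 : ((1 : ZMod p), (0 : ZMod p)) ∈ (f.subst δ).singSet := mem_singSet_subst f (by rwa [hrow])
  obtain ⟨hga, hgb⟩ := (one_zero_mem_singSet _).mp hg1
  have hg0 : ¬ ((f.subst δ).c = 0 ∧ (f.subst δ).d = 0) := fun h =>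
    ((subst_ne_zero_iff f hδdet).mpr hf) ⟨hga, hgb, h.1, h.2⟩
  have key := singSet_eq_of_a_eq_zero (f.subst δ) hga hgb hg0
  ext w
  -- `w ∈ sing f ⟺ w δ⁻¹ ∈ sing (f ∘ δ) ⟺ (w δ⁻¹).2 = 0 ⟺ w = t • v₀`
  have hw : w ∈ f.singSet ↔ rowMul w δ⁻¹ ∈ (f.subst δ).singSet := by
    rw [mem_singSet_subst_iff f hδdet, ← rowMul_mul, Matrix.nonsing_inv_mul δ hδdet, rowMul_one]
  rw [hw, key, Set.mem_setOf_eq, Set.mem_range]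
  have hw' : rowMul (rowMul w δ⁻¹) δ = w := by
    rw [← rowMul_mul, Matrix.nonsing_inv_mul δ hδdet, rowMul_one]
  generalize rowMul w δ⁻¹ = w' at hw' ⊢
  subst hw'
  obtain ⟨r, s⟩ := w'
  constructor
  · rintro (rfl : s = 0)
    refine ⟨r, ?_⟩
    rw [← hrow]
    simp only [rowMul, one_mul, zero_mul, add_zero, Prod.smul_mk, smul_eq_mul]
  · rintro ⟨t, ht⟩
    rw [← hrow] at ht
    simp only [rowMul, one_mul, zero_mul, add_zero, Prod.smul_mk, smul_eq_mul] at ht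
    -- `ht : (t δ₀₀, t δ₀₁) = (r, 0)δ`-shaped identity read back through `δ⁻¹`
    have h1 : rowMul (rowMul ((t : ZMod p), (0 : ZMod p)) δ) δ⁻¹ = rowMul (rowMul (r, s) δ) δ⁻¹ := by
      congr 1
      rw [show rowMul (r, s) δ = (r * δ 0 0 + s * δ 1 0, r * δ 0 1 + s * δ 1 1) from rfl, ← ht]
      simp only [rowMul, zero_mul, add_zero]
    rw [← rowMul_mul, ← rowMul_mul, Matrix.mul_nonsing_inv δ hδdet, rowMul_one, rowMul_one] at h1
    simp only [Prod.mk.injEq] at h1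
    exact h1.2.symm

/-- **`p − 1` nonzero singular zeros.** Over `𝔽_p`, a nonzero form with `Disc = 0` has exactly `p − 1`
singular zeros `≠ (0, 0)` (the nonzero multiples of its multiple root). [cite: BhargavaShankarTsimerman2012, proof of Lemma 12 (the unique multiple root in ℙ¹(𝔽_p))] -/
theorem card_singSet_ne_zero (hp : p.Prime) {f : BinaryCubic (ZMod p)}
    (hf : ¬ (f.a = 0 ∧ f.b = 0 ∧ f.c = 0 ∧ f.d = 0)) (hD : f.disc = 0) :
    Nat.card {v : ZMod p × ZMod p // v ∈ f.singSet ∧ v ≠ 0} = p - 1 := by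
  haveI : Fact p.Prime := ⟨hp⟩
  obtain ⟨v₀, hv₀, h0⟩ := exists_mem_singSet_ne_zero hp hf hD
  rw [singSet_eq_range_smul hp hf hv₀ h0]
  -- `t ↦ t • v₀` is a bijection from `{t ≠ 0}` onto the nonzero multiples
  have hsm0 : ∀ t : ZMod p, t • v₀ = 0 ↔ t = 0 := fun t =>
    ⟨fun h => (smul_eq_zero.mp h).resolve_right h0, fun h => by rw [h, zero_smul]⟩
  have hinj : Function.Injective fun t : ZMod p => t • v₀ := fun t t' h => by
    have h' : (t - t') • v₀ = 0 := by rw [sub_smul, sub_eq_zero]; exact h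
    exact sub_eq_zero.mp ((hsm0 _).mp h')
  have e : {t : ZMod p // t ≠ 0} ≃ {v : ZMod p × ZMod p // v ∈ Set.range (fun t : ZMod p => t • v₀) ∧ v ≠ 0} :=
    { toFun := fun t => ⟨t.1 • v₀, ⟨t.1, rfl⟩, fun h => t.2 ((hsm0 _).mp h)⟩
      invFun := fun v => ⟨v.2.1.choose, fun ht => v.2.2 (by rw [← v.2.1.choose_spec]; exact (hsm0 _).mpr ht)⟩
      left_inv := fun t => Subtype.ext (hinj (⟨t.1, rfl⟩ : ∃ s, (fun t : ZMod p => t • v₀) s = t.1 • v₀).choose_spec)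
      right_inv := fun v => Subtype.ext v.2.1.choose_spec }
  rw [← Nat.card_congr e, Nat.card_eq_fintype_card, Fintype.card_subtype_compl, ZMod.card,
    Fintype.card_unique]

end ZModP

end BinaryCubic

end Literature.NumberTheory.CubicFields
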